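import Literature.Combinatorics.LorentzianPolynomials.IndependentSets
import HarnessLib

/-!
# Parallel classes of a contraction `M/S`: "dependent together with `S`" is an equivalence relation on the non-loops
# (Brändén–Huh 2020, §4.3, proof of Thm. 4.10: "`P_1, …, P_ℓ ⊆ [n] ∖ L` the parallel classes in `M` [Oxley]", for `M/i`)

Layer `Literature/Combinatorics/LorentzianPolynomials`, namespace `Literature.Combinatorics.LorentzianPolynomials`;
lane `lit-hodgefound` (Track 2 foundations library), seat p16, generation 27 (row g27-#23). The combinatorial input for the
Hessian signatures of `f_M` (`IndependencePolynomial.lean`, `indepGenPoly_mem_lorentzian_iff`): for an independent set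
`S` of a Mathlib matroid `M` on `σ`, the elements `k ∉ S` with `S + k` independent (the non-loops of the contraction
`M/S`) are partitioned by "`S + k + l` is dependent" (parallel in `M/S`), and Brändén–Huh's proof of Thm. 4.10 runs through
these classes ("Write `L ⊆ [n]` for the set of loops and `P_1, …, P_ℓ ⊆ [n] ∖ L` for the parallel classes in `M`", applied
after "`∂_i Z_{q,M} = q^{-rk_M(i)} Z_{q,M/i}`, where `M/i` is the contraction of `M` by `i`"). Transitivity is proved
here directly from Mathlib's augmentation axiom `Matroid.Indep.augment` (no closure operator needed).

## Source (verbatim) — P. Brändén, J. Huh, *Lorentzian polynomials* [BrandenHuh2019] (held `paper:arxiv-1902.03719`)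

§4.3, proof of Thm. 4.10: "When `i ≠ 0`, we have `∂_i Z_{q,M} = q^{-rk_M(i)} Z_{q,M/i}`, where `M/i` is the contraction of
`M` by `i` [Oxley]. […] Write `L ⊆ [n]` for the set of loops and `P_1, …, P_ℓ ⊆ [n] ∖ L` for the parallel classes in `M`
[Oxley]. The above change of variables gives `Z^1_{q,M}(w) = e^1_{[n]}(w)` and
`Z^2_{q,M}(w) = e^2_{[n]}(w) - (1 - q)(e^2_{P_1}(w) + ⋯ + e^2_{P_ℓ}(w))`."

## What is here (`M : Matroid σ`, `S : Set σ`)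

* `nonloopsOver M S = {k ∉ S : S + k independent}` (the non-loops of `M/S` outside `S`);
* `ParallelOver M S k l`: `k, l ∈ nonloopsOver M S` and (`k = l` or `S + k + l` dependent) — "parallel in `M/S`";
* `indep_insert_insert_or` (the augmentation step: if `S + k + j` is independent and `l` is a non-loop of `M/S`, then
  `S + l + k` or `S + l + j` is independent), and **`ParallelOver.trans`**, with `.refl`, `.symm`,
  `parallelOver_equivalence` (an equivalence relation on `nonloopsOver M S`), `parallelOverSetoid`;
* `not_parallelOver_iff_indep` (for distinct non-loops: not parallel ⟺ `S + k + l` independent) and the bound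
  `ncard_nonloopsOver_le` (`#nonloopsOver M S ≤ n - #S`).

Two definitions with bodies (`nonloopsOver`, `ParallelOver`) and one `Setoid` built from them; theorems otherwise; no
`sorry`, no named fact.

## References

* [BrandenHuh2019] P. Brändén, J. Huh, *Lorentzian polynomials*, Ann. of Math. (2) 192 (2020) 821–891, arXiv:1902.03719 —
  §4.3 proof of Thm. 4.10 (contraction `M/i`, loops, parallel classes, citing [Oxley] = J. Oxley, *Matroid theory*).
-/

namespace Literature.Combinatorics.LorentzianPolynomials

variable {σ : Type*}

/-! ## §1 Non-loops and parallel elements of the contraction `M/S` -/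

section Defs

/-- **The non-loops of `M/S` outside `S`**: the `k ∉ S` with `S + k` independent. [cite: BrandenHuh2019, §4.3 proof of
Thm. 4.10 ("`L ⊆ [n]` the set of loops" of the contraction "`M/i`")] -/
def nonloopsOver (M : Matroid σ) (S : Set σ) : Set σ := {k | k ∉ S ∧ M.Indep (insert k S)}

/-- Unfolding `nonloopsOver`. [cite: BrandenHuh2019, §4.3 proof of Thm. 4.10] -/
theorem mem_nonloopsOver {M : Matroid σ} {S : Set σ} {k : σ} : k ∈ nonloopsOver M S ↔ k ∉ S ∧ M.Indep (insert k S) :=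
  Iff.rfl

/-- **Parallel in `M/S`** (or equal): non-loops `k, l` of `M/S` with `S + k + l` dependent, or `k = l`.
[cite: BrandenHuh2019, §4.3 proof of Thm. 4.10 ("the parallel classes" of the contraction)] -/
def ParallelOver (M : Matroid σ) (S : Set σ) (k l : σ) : Prop :=
  k ∈ nonloopsOver M S ∧ l ∈ nonloopsOver M S ∧ (k = l ∨ ¬ M.Indep (insert k (insert l S)))

/-- Unfolding `ParallelOver`. [cite: BrandenHuh2019, §4.3 proof of Thm. 4.10] -/
theorem parallelOver_iff {M : Matroid σ} {S : Set σ} {k l : σ} :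
    ParallelOver M S k l ↔ k ∈ nonloopsOver M S ∧ l ∈ nonloopsOver M S ∧ (k = l ∨ ¬ M.Indep (insert k (insert l S))) :=
  Iff.rfl

/-- Reflexivity on non-loops. [cite: BrandenHuh2019, §4.3 proof of Thm. 4.10] -/
theorem ParallelOver.refl {M : Matroid σ} {S : Set σ} {k : σ} (hk : k ∈ nonloopsOver M S) : ParallelOver M S k k :=
  ⟨hk, hk, Or.inl rfl⟩

/-- Symmetry. [cite: BrandenHuh2019, §4.3 proof of Thm. 4.10] -/
theorem ParallelOver.symm {M : Matroid σ} {S : Set σ} {k l : σ} (h : ParallelOver M S k l) : ParallelOver M S l k := by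
  obtain ⟨hk, hl, h⟩ := h
  refine ⟨hl, hk, h.imp Eq.symm fun hd hi ↦ hd ?_⟩
  rwa [Set.insert_comm]

/-- The left element of a parallel pair is a non-loop. [cite: BrandenHuh2019, §4.3 proof of Thm. 4.10] -/
theorem ParallelOver.left_mem {M : Matroid σ} {S : Set σ} {k l : σ} (h : ParallelOver M S k l) : k ∈ nonloopsOver M S := h.1

/-- The right element of a parallel pair is a non-loop. [cite: BrandenHuh2019, §4.3 proof of Thm. 4.10] -/
theorem ParallelOver.right_mem {M : Matroid σ} {S : Set σ} {k l : σ} (h : ParallelOver M S k l) : l ∈ nonloopsOver M S :=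
  h.2.1

end Defs

/-! ## §2 Transitivity from the augmentation axiom -/

section Trans

/-- **The augmentation step.** If `S + k + j` is independent (`k, j ∉ S` distinct) and `l ∉ S ∪ {k, j}` is a non-loop of
`M/S`, then `S + l + k` or `S + l + j` is independent: augment the independent set `S + l` (of size `#S + 1`) from
`S + k + j` (of size `#S + 2`). [cite: BrandenHuh2019, §4.3 proof of Thm. 4.10 (parallel classes of `M/i`, [Oxley])] -/
theorem indep_insert_insert_or [Fintype σ] {M : Matroid σ} {S : Set σ} {k j l : σ} (hkj : M.Indep (insert k (insert j S)))
    (hkS : k ∉ S) (hjS : j ∉ S) (hkj' : k ≠ j) (hl : l ∈ nonloopsOver M S) (hlk : l ≠ k) (hlj : l ≠ j) :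
    M.Indep (insert k (insert l S)) ∨ M.Indep (insert j (insert l S)) := by
  obtain ⟨hlS, hlI⟩ := hl
  have hS : S.Finite := Set.toFinite S
  have hc1 : (insert l S).ncard = S.ncard + 1 := Set.ncard_insert_of_notMem hlS hS
  have hc2 : (insert k (insert j S)).ncard = S.ncard + 2 := by
    rw [Set.ncard_insert_of_notMem (by rintro (h | h); exacts [hkj' h, hkS h]) (hS.insert j),
      Set.ncard_insert_of_notMem hjS hS]
  obtain ⟨x, ⟨hx1, hx2⟩, hx⟩ := exists_insert_indep_of_ncard_lt hlI hkj (by rw [hc1, hc2]; omega)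
  -- `x ∈ (S + k + j) ∖ (S + l)` is `k` or `j`
  have hxS : x ∉ S := fun h ↦ hx2 (Set.mem_insert_of_mem l h)
  rcases hx1 with rfl | rfl | hxS'
  · exact Or.inl hx
  · exact Or.inr hx
  · exact (hxS hxS').elim

/-- **Transitivity: "parallel in `M/S`" is transitive** — if `S + k + l` and `S + l + j` are dependent for non-loops
`k, l, j`, then so is `S + k + j` (else the augmentation step from `S + l` into `S + k + j` would make one of them
independent). [cite: BrandenHuh2019, §4.3 proof of Thm. 4.10 ("the parallel classes in `M`" [Oxley])] -/
theorem ParallelOver.trans [Fintype σ] {M : Matroid σ} {S : Set σ} {k l j : σ} (h₁ : ParallelOver M S k l)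
    (h₂ : ParallelOver M S l j) : ParallelOver M S k j := by
  obtain ⟨hk, hl, h1⟩ := h₁
  obtain ⟨-, hj, h2⟩ := h₂
  refine ⟨hk, hj, ?_⟩
  rcases h1 with rfl | hkl
  · exact h2
  rcases h2 with rfl | hlj
  · exact Or.inr hkl
  by_cases hkj : k = j
  · exact Or.inl hkj
  refine Or.inr fun hkjI ↦ ?_
  have hlk : l ≠ k := fun h ↦ hkl (by rw [h, Set.insert_eq_of_mem (Set.mem_insert k S)]; exact hk.2)
  have hlj' : l ≠ j := fun h ↦ hlj (by rw [h, Set.insert_eq_of_mem (Set.mem_insert j S)]; exact hj.2)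
  rcases indep_insert_insert_or hkjI hk.1 hj.1 hkj hl hlk hlj' with h | h
  · exact hkl h
  · exact hlj (by rwa [Set.insert_comm])

/-- "Parallel in `M/S`" is an equivalence relation on the non-loops of `M/S`.
[cite: BrandenHuh2019, §4.3 proof of Thm. 4.10 ("`P_1, …, P_ℓ` […] the parallel classes")] -/
theorem parallelOver_equivalence [Fintype σ] (M : Matroid σ) (S : Set σ) :
    Equivalence fun k l : nonloopsOver M S ↦ ParallelOver M S k l :=
  ⟨fun k ↦ ParallelOver.refl k.2, fun h ↦ h.symm, fun h₁ h₂ ↦ h₁.trans h₂⟩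

/-- The setoid of parallel classes of `M/S` on its non-loops. [cite: BrandenHuh2019, §4.3 proof of Thm. 4.10] -/
def parallelOverSetoid [Fintype σ] (M : Matroid σ) (S : Set σ) : Setoid (nonloopsOver M S) :=
  ⟨fun k l ↦ ParallelOver M S k l, parallelOver_equivalence M S⟩

/-- For distinct non-loops, NOT parallel means `S + k + l` independent — the pairs contributing `w_k w_l` to the quadratic
part "`e^2_{[n]} - (e^2_{P_1} + ⋯ + e^2_{P_ℓ})`". [cite: BrandenHuh2019, §4.3 proof of Thm. 4.10] -/
theorem not_parallelOver_iff_indep {M : Matroid σ} {S : Set σ} {k l : σ} (hk : k ∈ nonloopsOver M S)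
    (hl : l ∈ nonloopsOver M S) (hkl : k ≠ l) : ¬ ParallelOver M S k l ↔ M.Indep (insert k (insert l S)) := by
  rw [parallelOver_iff]
  constructor
  · intro h
    by_contra hi
    exact h ⟨hk, hl, Or.inr hi⟩
  · rintro hi ⟨-, -, h | h⟩
    exacts [hkl h, h hi]

/-- Elements of `S` and loops of `M/S` are parallel to nothing. [cite: BrandenHuh2019, §4.3 proof of Thm. 4.10
("`L ⊆ [n]` for the set of loops")] -/
theorem not_parallelOver_of_not_mem {M : Matroid σ} {S : Set σ} {k : σ} (hk : k ∉ nonloopsOver M S) (l : σ) :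
    ¬ ParallelOver M S k l := fun h ↦ hk h.1

end Trans

/-! ## §3 Counting: at most `n - #S` non-loops -/

section Card

variable [Fintype σ]

/-- The non-loops of `M/S` lie outside `S`, so there are at most `n - #S` of them (`n = |σ|`), hence at most `n - #S`
parallel classes ("Since `m ≤ n`" in Lemma 4.12). [cite: BrandenHuh2019, §4.3 Lemma 4.12 and proof of Thm. 4.10] -/
theorem ncard_nonloopsOver_le (M : Matroid σ) (S : Set σ) : (nonloopsOver M S).ncard ≤ Fintype.card σ - S.ncard := by
  have hsub : nonloopsOver M S ⊆ Sᶜ := fun k hk ↦ hk.1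
  have h1 : (nonloopsOver M S).ncard ≤ Sᶜ.ncard := Set.ncard_le_ncard hsub (Set.toFinite _)
  have h2 : Sᶜ.ncard = Fintype.card σ - S.ncard := by
    rw [← Nat.card_eq_fintype_card, ← Set.ncard_univ, ← Set.ncard_sdiff (Set.subset_univ S), Set.compl_eq_univ_sdiff]
  omega

end Card

end Literature.Combinatorics.LorentzianPolynomials
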